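import Summits.BirchSwinnertonDyer.BirchSwinnertonDyer.Theorems.AlignedTransportAtTwoMainConjectureOfRankZeroBSDAtTwoTwistSaturation
import Summits.BirchSwinnertonDyer.BirchSwinnertonDyer.Theorems.AlignedTransportAtTwoMainConjectureOfRankZeroBSDAtTwoCyclotomicLayerRankJumpExact
import HarnessLib

/-!
# Route `AlignedTransportAtTwo`, crux C2 `MainConjectureOfRankZeroBSDAtTwo` (stmt-BirchSwinnertonDyer-22298):
# THE FULL WEIGHT BUDGET WITH `μ` — `μ(X(W/ℚ_∞)) + ∑_n (rank W(ℚ_{n+1}) − rank W(ℚ_n)) / φ(p^{n+1}) + 2t ≤ ord_p∏c_ℓ + 2e + s` for EVERY good ordinary `p`,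
# every finite set of layers, UNCONDITIONALLY: the `μ`-invariant and the Mordell–Weil multiplicities of ALL layer primes share ONE Euler weight

HONEST FRAMING (cell `bsd-f1-sign2`, WIDTH-5 attached prover seat `bsd-line-att-p5` gen 46 on line `birth` of the lead `bsd-line-att-p2`;
`--supports` stmt-BirchSwinnertonDyer-22298, closes nothing; BSD is NOT proved by any of this; the crux C2, its verdict «blocked-on
`Rank1Residual.GreenbergMuConjectureIrreducible`» and every registered stub are untouched). THEOREMS ONLY — no `def`, no instance, no named fact, no `sorry`.

Sequel of `…TwistSaturation` (p811907: the layer `ℚ_1 = ℚ(√2)`, multiplicity `rank W⁽²⁾(ℚ)`) and of g37's `…CyclotomicLayerWeightEuler.card_growthLayers_add_le_of_thm41`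
(`#growth layers + 2t ≤ v + 2e + s`, NO `μ`-term, multiplicity one per layer). Both are shadows of one inequality: with `f_X` a generator of `char_Λ X(W/ℚ_∞)`,
`Ψ_n = Φ_{p^{n+1}}(1+T)` the layer primes (pairwise non-associated, each of weight `‖Ψ_n(0)‖ = p⁻¹`, none dividing `p`), g36's EXACT JUMP
`Ψ_n^{m_n} ∣ f_X` with `m_n = (rank W(ℚ_{n+1}) − rank W(ℚ_n)) / (pⁿ(p−1))` (`…CyclotomicLayerRankJumpExact.cyclotomicLayer_pow_jump_div_dvd`), and `f_X = p^{μ}·f₀`: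
**`∏_n Ψ_n^{m_n} ∣ f₀`**, so `‖f_X(0)‖ ≤ p^{−(μ + ∑ m_n)}`; Greenberg's Thm 4.1 (tree theorem) prices the left side.

* §1 (algebra, any `p`) `prod_cyclotomicLayer_pow_dvd_of_forall_pow_dvd` (distinct layer primes to arbitrary powers divide simultaneously — primality, no UFD),
  `norm_constantCoeff_prod_cyclotomicLayer_pow`, ★ `norm_constantCoeff_le_of_forall_cyclotomicLayer_pow_dvd` (**`‖G(0)‖ ≤ p^{−(μ(G) + ∑ m_n)}`**),
  `mu_add_sum_le_of_forall_cyclotomicLayer_pow_dvd`.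
* §2 (datum level, `W/ℚ` globally minimal, good ordinary at `p`, `Sel_{p^∞}(W/ℚ)` finite, cyclotomic `(κ, γ)`) ★★★ `mu_add_sum_rankJump_div_le`:
  **`μ(X) + ∑_{n ∈ S} (rank W(ℚ_{n+1}) − rank W(ℚ_n)) / (pⁿ(p−1)) + 2t ≤ ord_p∏c_ℓ + 2e + s`** for every finite `S ⊂ ℕ` — NO named fact.
  At `p = 2`, `S = {0}`: p811907 (`ℚ_1 = ℚ(√2)`, the jump is `rank W⁽²⁾(ℚ)`); `S` = growth layers, `μ` dropped: g37. NEW USES: `μ = 0` from points spread over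
  SEVERAL layers (e.g. `a₂ = −1`, `e = 2`: two points on `W⁽²⁾` AND one Galois orbit of points over `ℚ(ζ₁₆)⁺` give `2 + 1 < 4` — not yet; two orbits give `4`:
  saturation); and the bound `∑_n m_n ≤ e(W) − μ` on ALL future Mordell–Weil growth of a seed with known `μ`.
* §3 ★★ `mu_eq_zero_of_sum_rankJump_div_ge` — multi-layer saturation ⟹ `μ = 0`.

References: R. Greenberg, LNM 1716 (1999), Thm. 1.9, Thm. 4.1, §5 p. 132 [GreenbergLNM1716]; M. Kurihara, R. Pollack, §3.1 [KuriharaPollack2007];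
L. Washington, GTM 83, §7.1, §13.2 [Washington1997].
-/

set_option linter.dupNamespace false
set_option autoImplicit false

noncomputable section

open scoped Classical Polynomial

namespace Summit.BirchSwinnertonDyer.BirchSwinnertonDyer.Theorems.AlignedTransportAtTwoTwistSaturation

open Polynomial WeierstrassCurve Literature.NumberTheory.EllipticCurves
  Literature.NumberTheory.EllipticCurves.Rank1Residual
  Literature.NumberTheory.EllipticCurves.Greenberg1999
  Literature.NumberTheory.EllipticCurves.Module
  Literature.NumberTheory.EllipticCurves.IwasawaAlgebra
  Summit.BirchSwinnertonDyer.Rank1Residual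
  Summit.BirchSwinnertonDyer.Rank1Residual.X1.MuLambda
  Summit.BirchSwinnertonDyer.Rank1Residual.X1.MuPart
  Summit.BirchSwinnertonDyer.Rank1Residual.X1.ParitySqueeze
  Summit.BirchSwinnertonDyer.Rank1Residual.Iwasawa
  Summit.BirchSwinnertonDyer.BirchSwinnertonDyer.Theorems.Rank1ResidualX1Defs
  Summit.BirchSwinnertonDyer.BirchSwinnertonDyer.Theorems.DefectPrime
  Summit.BirchSwinnertonDyer.Rank1Residual.X1.CyclotomicZeros
  Summit.BirchSwinnertonDyer.BirchSwinnertonDyer.Theorems.AlignedTransportAtTwoCyclotomicLayerPrime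
  Summit.BirchSwinnertonDyer.BirchSwinnertonDyer.Theorems.AlignedTransportAtTwoCyclotomicLayerRankBudget
  Summit.BirchSwinnertonDyer.BirchSwinnertonDyer.Theorems.AlignedTransportAtTwoCyclotomicLayerLFunction
  Summit.BirchSwinnertonDyer.BirchSwinnertonDyer.Theorems.AlignedTransportAtTwoCyclotomicLayerWeight
  Summit.BirchSwinnertonDyer.BirchSwinnertonDyer.Theorems.AlignedTransportAtTwoCyclotomicLayerWeightEuler
  Summit.BirchSwinnertonDyer.BirchSwinnertonDyer.Theorems.AlignedTransportAtTwoCyclotomicLayerRankJumpExact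
  Summit.BirchSwinnertonDyer.BirchSwinnertonDyer.Theorems.TwoAdicEulerCharKernel

/-! ## §1 Algebra: powers of distinct layer primes divide simultaneously; their weight -/

section Algebra

variable {p : ℕ} [hp : Fact p.Prime]

/-- **Powers of distinct layer primes dividing `f` divide it simultaneously**: `(∀ n ∈ S, Ψ_n^{m n} ∣ f) ⟹ ∏_{n∈S} Ψ_n^{m n} ∣ f` (each `Ψ_a` is prime and
divides no `Ψ_n`, `n ≠ a`; `Prime.pow_dvd_of_dvd_mul_left`; no unique factorisation of `Λ` is used). [cite: Washington1997, §7.1] -/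
theorem prod_cyclotomicLayer_pow_dvd_of_forall_pow_dvd (S : Finset ℕ) (m : ℕ → ℕ) {f : PowerSeries ℤ_[p]}
    (h : ∀ n ∈ S, (((cyclotomic (p ^ (n + 1)) ℤ_[p]).comp (X + 1) : ℤ_[p][X]) : PowerSeries ℤ_[p]) ^ m n ∣ f) :
    (∏ n ∈ S, (((cyclotomic (p ^ (n + 1)) ℤ_[p]).comp (X + 1) : ℤ_[p][X]) : PowerSeries ℤ_[p]) ^ m n) ∣ f := by
  induction S using Finset.induction_on with
  | empty => simp
  | insert a S haS ih =>
    rw [Finset.prod_insert haS]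
    obtain ⟨g, hg⟩ := ih (fun n hn ↦ h n (Finset.mem_insert_of_mem hn))
    have ha := h a (Finset.mem_insert_self a S)
    rw [hg] at ha
    have hnd : ¬ (((cyclotomic (p ^ (a + 1)) ℤ_[p]).comp (X + 1) : ℤ_[p][X]) : PowerSeries ℤ_[p]) ∣
        ∏ n ∈ S, (((cyclotomic (p ^ (n + 1)) ℤ_[p]).comp (X + 1) : ℤ_[p][X]) : PowerSeries ℤ_[p]) ^ m n := by
      intro h1
      obtain ⟨n, hn, hdvd⟩ := (prime_coe_cyclotomic_comp p a).exists_mem_finset_dvd h1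
      have hdvd' := (prime_coe_cyclotomic_comp p a).dvd_of_dvd_pow hdvd
      exact haS ((eq_of_cyclotomicLayer_dvd hdvd') ▸ hn)
    obtain ⟨g', rfl⟩ := (prime_coe_cyclotomic_comp p a).pow_dvd_of_dvd_mul_left (m a) hnd ha
    exact ⟨g', by rw [hg]; ring⟩

/-- `‖(∏_{n∈S} Ψ_n^{m n})(0)‖ = p^{−∑ m n}` (each layer prime has weight one). [folklore] -/
theorem norm_constantCoeff_prod_cyclotomicLayer_pow (S : Finset ℕ) (m : ℕ → ℕ) :
    ‖PowerSeries.constantCoeff (∏ n ∈ S, (((cyclotomic (p ^ (n + 1)) ℤ_[p]).comp (X + 1) : ℤ_[p][X]) : PowerSeries ℤ_[p]) ^ m n)‖ =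
      (p : ℝ)⁻¹ ^ (∑ n ∈ S, m n) := by
  induction S using Finset.induction_on with
  | empty => simp
  | insert a S haS ih =>
    rw [Finset.prod_insert haS, Finset.sum_insert haS, map_mul, norm_mul, ih, map_pow, norm_pow, norm_constantCoeff_cyclotomicLayer,
      pow_add]

/-- ★ **THE WEIGHT OF `μ` AND OF LAYER-PRIME POWERS: `(∀ n ∈ S, Ψ_n^{m n} ∣ G) ⟹ ‖G(0)‖ ≤ p^{−(μ(G) + ∑ m n)}`** (`G = p^{μ}·G₀`, no `Ψ_n` divides `p`, so the
product of the powers divides `G₀`). [cite: Washington1997, §7.1 and §13.2] -/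
theorem norm_constantCoeff_le_of_forall_cyclotomicLayer_pow_dvd (S : Finset ℕ) (m : ℕ → ℕ) {G : PowerSeries ℤ_[p]}
    (h : ∀ n ∈ S, (((cyclotomic (p ^ (n + 1)) ℤ_[p]).comp (X + 1) : ℤ_[p][X]) : PowerSeries ℤ_[p]) ^ m n ∣ G) :
    ‖PowerSeries.constantCoeff G‖ ≤ (p : ℝ)⁻¹ ^ (mu G + ∑ n ∈ S, m n) := by
  have hfac : G = PowerSeries.C ((p : ℤ_[p]) ^ mu G) * pfree G := eq_C_pow_mu_mul_pfree (p := p) G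
  have h0 : ∀ n ∈ S, (((cyclotomic (p ^ (n + 1)) ℤ_[p]).comp (X + 1) : ℤ_[p][X]) : PowerSeries ℤ_[p]) ^ m n ∣ pfree G := by
    intro n hn
    have hn' := h n hn
    rw [hfac] at hn'
    exact (prime_coe_cyclotomic_comp p n).pow_dvd_of_dvd_mul_left (m n) (not_cyclotomicLayer_dvd_C_pow n (mu G)) hn'
  have hdvd := prod_cyclotomicLayer_pow_dvd_of_forall_pow_dvd S m h0
  have hle := norm_constantCoeff_le_of_dvd hdvd
  rw [norm_constantCoeff_prod_cyclotomicLayer_pow] at hle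
  have hpn : ‖((p : ℤ_[p]) ^ mu G)‖ = (p : ℝ)⁻¹ ^ mu G := by rw [norm_pow, PadicInt.norm_p]
  calc ‖PowerSeries.constantCoeff G‖ = ‖((p : ℤ_[p]) ^ mu G)‖ * ‖PowerSeries.constantCoeff (pfree G)‖ := by
          conv_lhs => rw [hfac]
          rw [map_mul, PowerSeries.constantCoeff_C, norm_mul]
    _ ≤ (p : ℝ)⁻¹ ^ mu G * (p : ℝ)⁻¹ ^ (∑ n ∈ S, m n) := by rw [hpn]; gcongr
    _ = (p : ℝ)⁻¹ ^ (mu G + ∑ n ∈ S, m n) := by rw [pow_add]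

/-- **`‖G(0)‖ = p^{−w}` and `Ψ_n^{m n} ∣ G` for all `n ∈ S` ⟹ `μ(G) + ∑ m n ≤ w`.** [cite: Washington1997, §7.1 and §13.2] -/
theorem mu_add_sum_le_of_forall_cyclotomicLayer_pow_dvd (S : Finset ℕ) (m : ℕ → ℕ) {G : PowerSeries ℤ_[p]} {w : ℕ}
    (hw : ‖PowerSeries.constantCoeff G‖ = (p : ℝ)⁻¹ ^ w)
    (h : ∀ n ∈ S, (((cyclotomic (p ^ (n + 1)) ℤ_[p]).comp (X + 1) : ℤ_[p][X]) : PowerSeries ℤ_[p]) ^ m n ∣ G) :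
    mu G + ∑ n ∈ S, m n ≤ w := by
  have hle := norm_constantCoeff_le_of_forall_cyclotomicLayer_pow_dvd S m h
  rw [hw] at hle
  have hp1 : (1 : ℝ) < p := by exact_mod_cast hp.out.one_lt
  have h0 : (0 : ℝ) < (p : ℝ)⁻¹ := inv_pos.mpr (by linarith)
  have h1 : (p : ℝ)⁻¹ < 1 := inv_lt_one_of_one_lt₀ hp1
  exact (pow_le_pow_iff_right_of_lt_one₀ h0 h1).mp hle

end Algebra

/-! ## §2 The full weight budget with `μ`, datum level, every good ordinary `p` -/

section Datum

variable {p : ℕ} [hp : Fact p.Prime] (W : WeierstrassCurve ℚ) [W.IsElliptic] [W.IsGloballyMinimal]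
  {κ : ZpExtension ℚ p} {γ : Field.absoluteGaloisGroup ℚ}

/-- ★★★ **THE FULL WEIGHT BUDGET WITH `μ` — UNCONDITIONAL.** `W/ℚ` globally minimal, good ordinary at `p` (`IsOrdinaryAt W p`), `Sel_{p^∞}(W/ℚ)` finite, `(κ, γ)` the
cyclotomic `ℤ_p`-extension with normalised topological generator, `D` any dual datum; `#W(ℚ)[p^∞] = p^t`, `#Ẽ(𝔽_p)[p^∞] = p^e`, `#Sel_{p^∞}(W/ℚ) = p^s`,
`v = ord_p∏c_ℓ`. Then for EVERY finite set `S` of layers: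
**`μ(X(W/ℚ_∞)) + ∑_{n∈S} (rank W(ℚ_{n+1}) − rank W(ℚ_n)) / (pⁿ(p−1)) + 2t ≤ v + 2e + s`** — the `μ`-invariant and the Mordell–Weil multiplicities of all
layer primes are paid out of ONE Euler weight (g36 exact jumps + §1 + Greenberg Thm 4.1, tree theorem). [cite: GreenbergLNM1716, Thm. 1.9, Thm. 4.1, §5 p. 132]
[cite: KuriharaPollack2007, §3.1] [cite: Washington1997, §13.2] -/
theorem mu_add_sum_rankJump_div_le (hord : IsOrdinaryAt W p) (hκ : κ.IsCyclotomic) (hγ : κ.IsTopGenerator γ)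
    (hγ' : IsCyclotomicVariable p γ) (D : W.SelmerDualData κ γ) (hfin : Finite (W.selmerGroupPInfty p)) {t e s : ℕ}
    (ht : Nat.card (AddCommGroup.primaryComponent W.toAffine.Point p) = p ^ t)
    (he : Nat.card (AddCommGroup.primaryComponent ((integralModelInt W).map (Int.castRingHom (ZMod p))).toAffine.Point p) = p ^ e)
    (hs : Nat.card (W.selmerGroupPInfty p) = p ^ s) (S : Finset ℕ) :
    D.mu + ∑ n ∈ S, ((W.baseChange (κ.layer (n + 1))).mordellWeilRank - (W.baseChange (κ.layer n)).mordellWeilRank) / (p ^ n * (p - 1))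
      + 2 * t ≤ padicValNat p W.tamagawaProduct + 2 * e + s := by
  haveI : Module.Finite (IwasawaAlgebra p) D.X := D.module_finite_holds hγ
  haveI : (charIdeal (IwasawaAlgebra p) D.X).IsPrincipal := charIdeal_isPrincipal_holds p D.X
  obtain ⟨fX, hfX⟩ := Submodule.IsPrincipal.principal (charIdeal (IwasawaAlgebra p) D.X)
  have hchar : D.charIdeal = Ideal.span {fX} := hfX
  have hD : D.IsTorsion :=
    D.isTorsion_of_finite_selmerGroup_rat hκ
      (W.hasGoodReductionAt_and_hasUnitRootAt_of_rat ((isOrdinaryAt_iff W p).mp hord).1 ((isOrdinaryAt_iff W p).mp hord).2) hγ hfin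
  obtain ⟨hineq, hnorm⟩ := norm_constantCoeff_charGen_eq_of_thm41 W thm41_charValue_rankZero_anyPrime_holds
    ((isOrdinaryAt_iff W p).mp hord).1 ((isOrdinaryAt_iff W p).mp hord).2 hκ hγ hγ' D hD hchar hfin ht he hs
  have hmem : fX ∈ D.charIdeal := by rw [hchar]; exact Ideal.mem_span_singleton_self _
  have hdvd : ∀ n ∈ S, (((cyclotomic (p ^ (n + 1)) ℤ_[p]).comp (X + 1) : ℤ_[p][X]) : PowerSeries ℤ_[p]) ^
      (((W.baseChange (κ.layer (n + 1))).mordellWeilRank - (W.baseChange (κ.layer n)).mordellWeilRank) / (p ^ n * (p - 1))) ∣ fX :=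
    fun n _ => cyclotomicLayer_pow_jump_div_dvd W hγ D hD hmem n
  have hle := mu_add_sum_le_of_forall_cyclotomicLayer_pow_dvd S _ hnorm hdvd
  have hfX0 : PowerSeries.constantCoeff fX ≠ 0 := by
    intro h0
    rw [h0, norm_zero] at hnorm
    have hp0 : (0 : ℝ) < (p : ℝ)⁻¹ := inv_pos.mpr (by exact_mod_cast hp.out.pos)
    exact (pow_ne_zero _ hp0.ne') hnorm.symm
  have hfXne : fX ≠ 0 := fun h0 => hfX0 (by rw [h0, map_zero])
  have hmufX : mu fX = D.mu := mu_generator_eq_muInvariant D.X hD hfXne hchar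
  rw [← hmufX]
  omega

/-- ★★ **MULTI-LAYER SATURATION ⟹ `μ = 0`.** Same hypotheses; if for some finite set `S` of layers the Mordell–Weil multiplicities exhaust the weight,
`v + 2e + s ≤ ∑_{n∈S} (rank W(ℚ_{n+1}) − rank W(ℚ_n))/(pⁿ(p−1)) + 2t`, then `μ(X(W/ℚ_∞)) = 0`. (`S = {0}` at `p = 2`: p811907's twist-saturation door.)
[cite: GreenbergLNM1716, Thm. 1.9, Thm. 4.1, §5 p. 132] -/
theorem mu_eq_zero_of_sum_rankJump_div_ge (hord : IsOrdinaryAt W p) (hκ : κ.IsCyclotomic) (hγ : κ.IsTopGenerator γ)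
    (hγ' : IsCyclotomicVariable p γ) (D : W.SelmerDualData κ γ) (hfin : Finite (W.selmerGroupPInfty p)) {t e s : ℕ}
    (ht : Nat.card (AddCommGroup.primaryComponent W.toAffine.Point p) = p ^ t)
    (he : Nat.card (AddCommGroup.primaryComponent ((integralModelInt W).map (Int.castRingHom (ZMod p))).toAffine.Point p) = p ^ e)
    (hs : Nat.card (W.selmerGroupPInfty p) = p ^ s) (S : Finset ℕ)
    (hsat : padicValNat p W.tamagawaProduct + 2 * e + s ≤
      ∑ n ∈ S, ((W.baseChange (κ.layer (n + 1))).mordellWeilRank - (W.baseChange (κ.layer n)).mordellWeilRank) / (p ^ n * (p - 1)) + 2 * t) :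
    D.mu = 0 := by
  have h := mu_add_sum_rankJump_div_le W hord hκ hγ hγ' D hfin ht he hs S
  omega

end Datum

end Summit.BirchSwinnertonDyer.BirchSwinnertonDyer.Theorems.AlignedTransportAtTwoTwistSaturation

end
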